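import Summits.CriticalPhenomena.CardyFormulaZ2.Theorems.CardyQContinuationIsingJetsConformalStubRcMeasureMonoDomainWired
import Literature.Probability.LatticeModels.RandomClusterConditionalDomination
import Literature.Probability.LatticeModels.RandomClusterSuccessiveConditioning
import Literature.Probability.LatticeModels.FKIsingAnnulusCrossingProofs

/-!
# Crux `IsingJetsConformal`, stub `stub_loopSymmetricLimit_sandwichLower`:
# the lower half of the sandwich of the tree's discretisation between Chelkak–Smirnov quadrilaterals
# (route `CardyQContinuation`, item stmt-CriticalPhenomena-5560, `n = 0` bridge, lemma L1)

In the `n = 0` bridge of the crux the FK-Ising crossing probability of the tree's discretisation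
`Ω_δ` (edge set `EΩ`, wired arcs `W`) is squeezed between the crossing probabilities of two
Chelkak–Smirnov discrete quadrilaterals. This file is the abstract LOWER half: a quadrilateral `Q`
(edge set `EQ`, wired black arcs `BQ`) glued to `Ω_δ` from outside along its wired arcs, inside a
common finite graph `G ⊇ EΩ ∪ EQ` on the vertex type `V`, in which

* every edge of `G` that is not an `Ω_δ`-edge touches `Ω_δ`-vertices (vertices incident to some
  `EΩ`-edge) only inside `W`, and
* `BQ` meets `Ω_δ`-vertices only inside `W`.

If a `Q`-crossing (an increasing event `AQ` read on `ω ∩ EQ`) deterministically forces the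
increasing `Ω_δ`-event `A` (determined by `ω ∩ EΩ`), then
`φ^{BQ}_{⟨EQ⟩,p,q}(AQ) ≤ φ^{W ∪ idle}_{⟨EΩ⟩,p,q}(A)`, `idle = {x | x is incident to no EΩ-edge}`
(the isolated vertices of `⟨EΩ⟩`, harmlessly wired), for `0 ≤ p < 1`, `q ≥ 1`. The chain of
proved comparison inequalities of the `Literature` library is

1. `φ^{BQ}_{⟨EQ⟩}(AQ) ≤ φ^{BQ}_G({ω | ω ∩ EQ ∈ AQ})` — monotonicity in the domain
   (`rcMeasure_fromEdgeSet_real_le`, Grimmett 2006, Thm. (3.1)(a), Lemma (4.14); its non-nullity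
   hypothesis from `p < 1`, `rcMeasure_real_offRegionClosed_pos_of_lt_one`);
2. `≤ φ^{BQ}_G({ω | ω ∩ EΩ ∈ A})` — the deterministic implication, for lattice configurations
   (`rcMeasure_real_mono_of_forall_subset_edgeSet`);
3. `≤ φ^{W ∪ idle}_{⟨EΩ⟩}(A)` — conditionally on every configuration `ξ` off `EΩ` the law of
   `ω ∩ EΩ` is dominated by the measure of `⟨EΩ⟩` wired on `BQ` and on the vertices touched by
   `ξ`, all inside `W ∪ idle` (`rcMeasure_real_inter_cylinder_le_mul_fromEdgeSet`, Grimmett 2006,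
   Lemma (4.13) with Lemma (4.14)(b); Duminil-Copin–Smirnov 2012, Thm. 3.1 and §3.2), and a bound
   uniform in `ξ` passes to the whole space (`rcMeasure_real_inter_le_mul_of_cylinder_le`,
   Duminil-Copin–Smirnov 2012, §6.1).

References: G. Grimmett, *The Random-Cluster Model*, Springer (2006), Thm. (3.1)(a), Lemmas
(4.13), (4.14); H. Duminil-Copin, S. Smirnov, *Conformal invariance of lattice models*, Clay Math.
Proc. 15 (2012), Thm. 3.1, §3.2, §6.1; D. Chelkak, S. Smirnov, Invent. Math. 189 (2012), §1.2.
-/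

namespace Summit.CriticalPhenomena.CardyFormulaZ2.Theorems.CardyQContinuation

open MeasureTheory SimpleGraph
open Literature.Probability.LatticeModels
open Literature.Probability.Percolation

noncomputable section

namespace SandwichLower

/-- **Shrinking the domain while wiring every vertex touched from outside increases increasing
events** (Grimmett 2006, Lemma (4.13) with Lemma (4.14)(b); Duminil-Copin–Smirnov 2012, Thm. 3.1
with the domain Markov property §3.2, and the successive-conditioning step of §6.1): for
`U ⊆ E(G)`, `0 ≤ p ≤ 1`, `q ≥ 1`, a wired set `B ⊆ W` and a vertex set `W` containing both
endpoints of every edge of `G` off `U`, every increasing event `A` satisfies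
`φ^B_{G,p,q}({ω | ω ∩ U ∈ A}) ≤ φ^W_{⟨U⟩,p,q}(A)`: conditionally on each configuration `ξ` off `U`
the bound is `rcMeasure_real_inter_cylinder_le_mul_fromEdgeSet`, and it is uniform in `ξ`
(`rcMeasure_real_inter_le_mul_of_cylinder_le` with the trivial event `univ`).
[cite: Grimmett2006, Lemma (4.13) and Lemma (4.14)(b)] -/
theorem rcMeasure_real_le_fromEdgeSet_wired {V : Type*} [Fintype V] [DecidableEq V]
    (G : SimpleGraph V) [DecidableRel G.Adj] {p q : ℝ} (hp : p ∈ Set.Icc (0 : ℝ) 1)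
    (hq : 1 ≤ q) (B : Set V) (U : Finset (Sym2 V)) (hU : U ⊆ G.edgeFinset) {W : Set V}
    (hBW : B ⊆ W) (hW : ∀ e ∈ G.edgeFinset, e ∉ U → ∀ x ∈ e, x ∈ W)
    {A : Set (BondConfig V)} (hA : IsUpperSet A) :
    (rcMeasure G p q B).real {ω | ω ∩ ↑U ∈ A} ≤
      (rcMeasure (fromEdgeSet (U : Set (Sym2 V))) p q W).real A := by
  classical
  have hq0 : 0 < q := one_pos.trans_le hq
  haveI := isProbabilityMeasure_rcMeasure G hp hq0 B
  have hF : ∀ ω₁ ω₂ : BondConfig V, ω₁ ∩ (↑U)ᶜ = ω₂ ∩ (↑U)ᶜ →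
      (ω₁ ∈ (Set.univ : Set (BondConfig V)) ↔ ω₂ ∈ (Set.univ : Set (BondConfig V))) :=
    fun _ _ _ ↦ Iff.rfl
  have hθ : ∀ ξ : Finset (Sym2 V), ξ ⊆ G.edgeFinset \ U →
      (rcMeasure G p q B).real ({ω | ω ∩ ↑U ∈ A} ∩ {ω | ω ∩ (↑U : Set (Sym2 V))ᶜ = ↑ξ}) ≤
        (rcMeasure (fromEdgeSet (U : Set (Sym2 V))) p q W).real A *
          (rcMeasure G p q B).real {ω | ω ∩ (↑U : Set (Sym2 V))ᶜ = ↑ξ} := by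
    intro ξ hξ
    have hξW : ∀ e ∈ (↑ξ : Set (Sym2 V)), ∀ x ∈ e, x ∈ W := by
      intro e he x hx
      have he' := hξ (Finset.mem_coe.1 he)
      rw [Finset.mem_sdiff] at he'
      exact hW e he'.1 he'.2 x hx
    rw [mul_comm]
    exact rcMeasure_real_inter_cylinder_le_mul_fromEdgeSet G hp hq B U hU (↑ξ) hBW hξW hA
  have h := rcMeasure_real_inter_le_mul_of_cylinder_le G hp hq0 B U hF hθ
  rwa [Set.inter_univ, probReal_univ, mul_one] at h

end SandwichLower

open SandwichLower

/-- **Stub `stub_loopSymmetricLimit_sandwichLower`** of the skeleton of the crux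
`IsingJetsConformal` (stmt-CriticalPhenomena-5560, `n = 0` bridge, lemma L1, the lower half of
the sandwich): a Chelkak–Smirnov quadrilateral `Q` (edges `EQ ⊆ E(G)`, wired arcs `BQ`) glued
outside the discretisation `Ω_δ` (edges `EΩ ⊆ E(G)`, wired arcs `W`) so that the non-`EΩ` edges of
`G` and the set `BQ` touch `EΩ`-vertices only inside `W`; if the increasing `Q`-event `AQ` read on
`ω ∩ EQ` forces the increasing, `EΩ`-determined event `A` for every lattice configuration, then
`φ^{BQ}_{⟨EQ⟩,p,q}(AQ) ≤ φ^{W ∪ idle}_{⟨EΩ⟩,p,q}(A)` with `idle = {x | ∀ e' ∈ EΩ, x ∉ e'}`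
(`0 ≤ p < 1`, `q ≥ 1`). Chain: domain monotonicity `rcMeasure_fromEdgeSet_real_le` (non-nullity
from `p < 1`), the deterministic implication `rcMeasure_real_mono_of_forall_subset_edgeSet`, and
`SandwichLower.rcMeasure_real_le_fromEdgeSet_wired` (conditional domination by the wired measure
of `⟨EΩ⟩`, uniform in the outside configuration). (Grimmett 2006, Thm. (3.1)(a), Lemmas (4.13),
(4.14); Duminil-Copin–Smirnov 2012, Thm. 3.1, §3.2, §6.1.)
[cite: Grimmett2006, Lemma (4.13) and Lemma (4.14)] -/
theorem stub_loopSymmetricLimit_sandwichLower : (∀ (V : Type) [Fintype V] [DecidableEq V] (G : SimpleGraph V) [DecidableRel G.Adj] (p q : ℝ), p ∈ Set.Icc (0 : ℝ) 1 → p < 1 → 1 ≤ q → ∀ (EΩ EQ : Finset (Sym2 V)), EΩ ⊆ G.edgeFinset → EQ ⊆ G.edgeFinset → ∀ (BQ W : Set V), (∀ e ∈ G.edgeFinset, e ∉ EΩ → ∀ x ∈ e, x ∈ W ∨ ∀ e' ∈ EΩ, x ∉ e') → (∀ x ∈ BQ, x ∈ W ∨ ∀ e' ∈ EΩ, x ∉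 e') → ∀ (AQ A : Set (Literature.Probability.Percolation.BondConfig V)), IsUpperSet AQ → IsUpperSet A → (∀ ω ω' : Literature.Probability.Percolation.BondConfig V, ω ∩ ↑EΩ = ω' ∩ ↑EΩ → (ω ∈ A ↔ ω' ∈ A)) → (∀ ω : Literature.Probability.Percolation.BondConfig V, ω ⊆ G.edgeSet → ω ∩ ↑EQ ∈ AQ → ω ∈ A) → (Literature.Probability.LatticeModels.rcMeasure (SimpleGraph.fromEdgeSet (↑EQ : Set (Sym2 V))) p q BQ).real AQ ≤ (Literature.Probability.LatticeModels.rcMeasure (SimpleGraph.fromEdgeSet (↑EΩ : Set (Sym2 V))) p q (W ∪ {x | ∀ e' ∈ EΩ, x ∉ e'})).real A) := by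
  intro V _ _ G _ p q hp hp1 hq EΩ EQ hEΩ hEQ BQ W hatt hBQ AQ A hAQ hA hdet hforce
  have hq0 : 0 < q := one_pos.trans_le hq
  -- (1) domain monotonicity `⟨EQ⟩ ↪ G` for the fixed wired set `BQ`
  have h0 : 0 < (rcMeasure G p q BQ).real {ω | ω ∩ (↑EQ : Set (Sym2 V))ᶜ = ∅} :=
    RcMeasureMonoDomainWired.rcMeasure_real_offRegionClosed_pos_of_lt_one G hp hp1 hq0 BQ _
  have h1 := rcMeasure_fromEdgeSet_real_le G hp hq BQ EQ hEQ h0 hAQ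
  -- (2) the deterministic implication `{ω ∩ EQ ∈ AQ} ⊆ A = {ω ∩ EΩ ∈ A}` on lattice configurations
  have h2 : (rcMeasure G p q BQ).real {ω | ω ∩ ↑EQ ∈ AQ} ≤
      (rcMeasure G p q BQ).real {ω | ω ∩ ↑EΩ ∈ A} :=
    rcMeasure_real_mono_of_forall_subset_edgeSet G hp hq0 BQ fun ω hω hωAQ ↦
      (hdet (ω ∩ ↑EΩ) ω (by rw [Set.inter_assoc, Set.inter_self])).2 (hforce ω hω hωAQ)
  -- (3) conditional domination by `⟨EΩ⟩` wired on `W ∪ idle ⊇ BQ`, uniform off `EΩ`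
  have hBW : BQ ⊆ W ∪ {x | ∀ e' ∈ EΩ, x ∉ e'} := fun x hx ↦ hBQ x hx
  have hW : ∀ e ∈ G.edgeFinset, e ∉ EΩ → ∀ x ∈ e, x ∈ W ∪ {x | ∀ e' ∈ EΩ, x ∉ e'} :=
    fun e he heΩ x hx ↦ hatt e he heΩ x hx
  have h3 := rcMeasure_real_le_fromEdgeSet_wired G hp hq BQ EΩ hEΩ hBW hW hA
  exact h1.trans (h2.trans h3)

end

end Summit.CriticalPhenomena.CardyFormulaZ2.Theorems.CardyQContinuation
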